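import Summits.AtomisticToContinuum.BoseEinsteinCondensation.Theorems.BECConjugateDominationInfraredMinimumUncertaintyPhaseSteinCut

/-!
# Line `fisher-gaussian-density-mode` — crux `BECConjugateDomination.InfraredMinimumUncertainty`
(stmt-AtomisticToContinuum-11784) · skeleton **gen 2, reshape r1, integration i2**
(lead prover-line-stmt-AtomisticToContinuum-11784-1, 2026-08-16; supersedes lead-0's i1 thin file of 06:40Z)

THIN skeleton over the tree. Everything the line proved is LANDED and imported, not restated:
`Theorems/BECConjugateDominationDefs.lean` (objects + named statements, p76007), `…FSum` (p76796),
`…Ladder` (p77164: `imu_of_fisher`, `fisherDomination_of_imu`, `densityMoment_of_imu`, …), `…Stein`/`…SteinForm`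
(p77146/p77369), `…SteinIdentity` (p77744), `…WeakEulerLagrange` (p78669), `…StubCoherenceRegular` (p77078),
`…GroundStateRepresentation` (p85985), `…PhaseSteinCut` (p86724: the four cut statements `SteinIdentity`,
`WeakEulerLagrange`, `CoherenceRegular`, `PhaseSteinDomination`, three of them closed, the glue
`fisherDominationV_of_parts` / `imu_of_phaseStein_of_fisherGaussianity`, and the necessity
`phaseSteinDomination_of_imu`), `Negative/PhaseSteinDominationNecessity` (p82312).

Registered stubs of reshape r1 (5): `stub_steinIdentity`, `stub_weakEulerLagrange`, `stub_coherenceRegular` —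
CLOSED in the tree (`steinIdentity_holds`, `weakEulerLagrange_holds`, `coherenceRegular_holds` of `…PhaseSteinCut`);
`stub_phaseSteinDomination` (PSD, the core) and `stub_densityFisherGaussianity` (FG) — OPEN, the only two
`sorry`s of this file, signatures byte-identical to the r1 registry.

Composition: `InfraredMinimumUncertainty_of` — the ONLY theorem of the file concluding the route decl by name —
is `imu_of_phaseStein_of_fisherGaussianity stub_phaseSteinDomination stub_densityFisherGaussianity`
(PSD ∧ FG ⇒ FD-V ∧ FG ⇒ IMU, constants `C_PSD · C_FG / 16`).

Status recorded by lead-1 (see `Lines/fisher-gaussian-density-mode.dead.md`): the core stub is the crux —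
`phaseSteinDomination_of_imu : InfraredMinimumUncertainty → PhaseSteinDomination` (p82312/p86724) and
`imu_of_phaseStein_of_fisherGaussianity : PhaseSteinDomination → FisherGaussianityV → InfraredMinimumUncertainty`
(p86724) are both kernel-checked, so modulo FG the line reduces IMU to IMU.
-/

noncomputable section

open MeasureTheory Filter Set Metric
open scoped ENNReal NNReal Topology ComplexConjugate BigOperators

namespace Summit.AtomisticToContinuum.BoseEinsteinCondensation.Cruxes.InfraredMinimumUncertainty.FisherGaussianDensityMode

open Literature.MathematicalPhysics.QuantumManyBody.BoseGas
open Summit.AtomisticToContinuum.BoseEinsteinCondensation.Theses.BECConjugateDomination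
  (InfraredMinimumUncertainty)

/-! ## Registered stubs (reshape r1): three closed in the tree (`…PhaseSteinCut`), two open -/

/-- **STUB (the lead's; OPEN; core of FD, crux-sized) — `PhaseSteinDomination`**: under the crux
hypotheses plus the weak Euler–Lagrange identity and the regularity of `g`: `∃ φ ∈ C¹, 16 ν_m ≤ C · J^S_m(φ)`. -/
theorem stub_phaseSteinDomination :
    ∀ v : ℝ → ℝ≥0∞, IsRepulsiveFiniteRange v → (∀ r, v r ≠ ⊤) →
      ContDiff ℝ 2 (fun x : Space => (v ‖x‖).toReal) →
      (∃ Cₑ : ℝ, ∀ x : Space,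
        ‖iteratedFDeriv ℝ 2 (fun x : Space => (v ‖x‖).toReal) x‖ ≤ Cₑ * Real.sqrt ((v ‖x‖).toReal)) →
      ∃ C : ℝ, 0 ≤ C ∧ ∃ ρ₀ : ℝ, 0 < ρ₀ ∧ ∀ ρ : ℝ, 0 < ρ → ρ < ρ₀ → ∀ᶠ n : ℕ in Filter.atTop,
        ∀ Ψ : PeriodicTrialState (n + 1) (sideLength ρ (n + 1)),
          periodicEnergy v Ψ = periodicGroundStateEnergy v (n + 1) (sideLength ρ (n + 1)) →
          periodicEnergy v Ψ ≠ ⊤ → (∀ X, Ψ.ψ X = (‖Ψ.ψ X‖ : ℂ)) → (∀ X, Ψ.ψ X ≠ 0) →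
          (∀ η : Config (n + 1) → ℂ, ContDiff ℝ 1 η →
            (∀ (X : Config (n + 1)) (i : Fin (n + 1)) (k : Fin 3),
              η (X + Pi.single i (EuclideanSpace.single k (sideLength ρ (n + 1)))) = η X) →
            (∀ (σ : Equiv.Perm (Fin (n + 1))) (X : Config (n + 1)), η (X ∘ σ) = η X) →
            (∫ X in cellN (n + 1) (sideLength ρ (n + 1)),
                ((∑ i : Fin (n + 1), ∑ k : Fin 3,
                    (starRingEnd ℂ (fderiv ℝ η X (Pi.single i (EuclideanSpace.single k (1 : ℝ)))) *
                      fderiv ℝ Ψ.ψ X (Pi.single i (EuclideanSpace.single k (1 : ℝ)))).re) +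
                  (periodicInteraction v (sideLength ρ (n + 1)) X).toReal *
                    (starRingEnd ℂ (η X) * Ψ.ψ X).re)) =
              (periodicGroundStateEnergy v (n + 1) (sideLength ρ (n + 1))).toReal *
                ∫ X in cellN (n + 1) (sideLength ρ (n + 1)), (starRingEnd ℂ (η X) * Ψ.ψ X).re) →
          Continuous (fun r : Space => ∫ x in cell (sideLength ρ (n + 1)), ∫ Y in cellN n (sideLength ρ (n + 1)),
              ‖Ψ.ψ (Matrix.vecCons (x + r) Y)‖ * ‖Ψ.ψ (Matrix.vecCons x Y)‖) →
          (∀ r : Space, 0 < ∫ x in cell (sideLength ρ (n + 1)), ∫ Y in cellN n (sideLength ρ (n + 1)),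
              ‖Ψ.ψ (Matrix.vecCons (x + r) Y)‖ * ‖Ψ.ψ (Matrix.vecCons x Y)‖) →
          ∀ m : Fin 3 → ℤ, m ≠ 0 →
            ∃ φ : ℂ → ℂ, ContDiff ℝ 1 φ ∧
              16 * (cellFourierCoeff (sideLength ρ (n + 1)) (fun r : Space => ((Real.log
                (∫ x in cell (sideLength ρ (n + 1)), ∫ Y in cellN n (sideLength ρ (n + 1)),
                  ‖Ψ.ψ (Matrix.vecCons (x + r) Y)‖ * ‖Ψ.ψ (Matrix.vecCons x Y)‖) : ℝ) : ℂ)) m).re ≤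
              C * (-(4 / ((n : ℝ) + 1)) *
                    (∫ X in cellN (n + 1) (sideLength ρ (n + 1)),
                      ((((n : ℝ) + 1 : ℝ) : ℂ) *
                          ((fderiv ℝ φ (∑ j : Fin (n + 1), cellWave (sideLength ρ (n + 1)) m (X j)) 1 -
                              Complex.I * fderiv ℝ φ (∑ j : Fin (n + 1), cellWave (sideLength ρ (n + 1)) m (X j))
                                Complex.I) / 2) -
                        (fderiv ℝ φ (∑ j : Fin (n + 1), cellWave (sideLength ρ (n + 1)) m (X j)) 1 +
                              Complex.I * fderiv ℝ φ (∑ j : Fin (n + 1), cellWave (sideLength ρ (n + 1)) m (X j))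
                                Complex.I) / 2 *
                          starRingEnd ℂ (∑ j : Fin (n + 1), cellWave (sideLength ρ (n + 1)) m (X j) ^ 2)).re *
                        ‖Ψ.ψ X‖ ^ 2) -
                  ∫ X in cellN (n + 1) (sideLength ρ (n + 1)),
                    ‖φ (∑ j : Fin (n + 1), cellWave (sideLength ρ (n + 1)) m (X j))‖ ^ 2 * ‖Ψ.ψ X‖ ^ 2) := by
  sorry

/-- **STUB 2 — `FisherGaussianityV`**: Fisher-Gaussianity of the density mode at its own scale:
`∀ φ continuous, J_m(φ) · (N S_m) ≤ C`. -/
theorem stub_densityFisherGaussianity :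
    ∀ v : ℝ → ℝ≥0∞, IsRepulsiveFiniteRange v → (∀ r, v r ≠ ⊤) →
      ContDiff ℝ 2 (fun x : Space => (v ‖x‖).toReal) →
      (∃ Cₑ : ℝ, ∀ x : Space,
        ‖iteratedFDeriv ℝ 2 (fun x : Space => (v ‖x‖).toReal) x‖ ≤ Cₑ * Real.sqrt ((v ‖x‖).toReal)) →
      ∃ C : ℝ, 0 ≤ C ∧ ∃ ρ₀ : ℝ, 0 < ρ₀ ∧ ∀ ρ : ℝ, 0 < ρ → ρ < ρ₀ → ∀ᶠ n : ℕ in Filter.atTop,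
        ∀ Ψ : PeriodicTrialState (n + 1) (sideLength ρ (n + 1)),
          periodicEnergy v Ψ = periodicGroundStateEnergy v (n + 1) (sideLength ρ (n + 1)) →
          periodicEnergy v Ψ ≠ ⊤ → (∀ X, Ψ.ψ X = (‖Ψ.ψ X‖ : ℂ)) → (∀ X, Ψ.ψ X ≠ 0) →
          ∀ m : Fin 3 → ℤ, m ≠ 0 →
            ∀ φ : ℂ → ℂ, Continuous φ →
              (-(4 / (((n : ℝ) + 1) * ‖((2 * Real.pi / sideLength ρ (n + 1)) • latticeVec 1 m)‖ ^ 2)) *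
                (∫ X in cellN (n + 1) (sideLength ρ (n + 1)), (starRingEnd ℂ (φ (∑ j : Fin (n + 1), cellWave (sideLength ρ (n + 1)) m (X j))) *
                  (∑ j : Fin (n + 1), cellWave (sideLength ρ (n + 1)) m (X j) *
                (((‖((2 * Real.pi / sideLength ρ (n + 1)) • latticeVec 1 m)‖ ^ 2 : ℝ) : ℂ) * Ψ.ψ X -
                  2 * Complex.I * fderiv ℝ Ψ.ψ X (Pi.single j ((2 * Real.pi / sideLength ρ (n + 1)) • latticeVec 1 m)))) * starRingEnd ℂ (Ψ.ψ X)).re) -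
              ∫ X in cellN (n + 1) (sideLength ρ (n + 1)), ‖φ (∑ j : Fin (n + 1), cellWave (sideLength ρ (n + 1)) m (X j))‖ ^ 2 * ‖Ψ.ψ X‖ ^ 2) *
              (((n : ℝ) + 1) * (((n : ℝ) + 1)⁻¹ * ∫ X in cellN (n + 1) (sideLength ρ (n + 1)),
                ‖∑ j : Fin (n + 1), cellWave (sideLength ρ (n + 1)) m (X j)‖ ^ 2 * ‖Ψ.ψ X‖ ^ 2)) ≤ C := by
  sorry


/-! ## The skeleton concludes the crux BY NAME -/

/-- **`InfraredMinimumUncertainty`** (route `BECConjugateDomination`, stmt-AtomisticToContinuum-11784) from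
the two open registered stubs (the three closed ones enter through `…PhaseSteinCut`) — the ONLY theorem of
this file concluding the route decl by name. -/
theorem InfraredMinimumUncertainty_of : InfraredMinimumUncertainty :=
  imu_of_phaseStein_of_fisherGaussianity stub_phaseSteinDomination stub_densityFisherGaussianity

end Summit.AtomisticToContinuum.BoseEinsteinCondensation.Cruxes.InfraredMinimumUncertainty.FisherGaussianDensityMode

end
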